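import Summits.BirchSwinnertonDyer.BirchSwinnertonDyer.Theorems.EisensteinDepletionAtTwoStarOptBSFSigmaNodeSeventeenFree
import Summits.BirchSwinnertonDyer.BirchSwinnertonDyer.Theorems.ByReductionTypeAtTwoOrdIsogenyTransport
import Literature.NumberTheory.EllipticCurves.BurungaleSkinner2023.Curve14a1TwistsCertificate
import Literature.NumberTheory.EllipticCurves.SzpiroOfAbcProofs
import Literature.NumberTheory.Automorphic.ThorneQInfinityModularSurjectivityProofs
import HarnessLib

/-!
# Line `star` on crux E1M (stmt-BirchSwinnertonDyer-20341): the `15a1` shape is impossible at EVERY level — the squarefree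
# hypothesis leaves the MID-walk residue (lead star-p1 GEN 20)

GEN 19's `false_of_fifteenShape_free` (Theorems/…StarOptBSFSigmaNodeFifteenFree) excluded the `+256`/`α = −34` shape of a MID point on the
lattice-optimal curve `W₀` of a habitat class by LEVEL bookkeeping: `Δ(W₀) = 3⁴·5⁴ ⇒ 15 ∣ N`, and `N = N_W` SQUAREFREE `⇒ N = 15`.  That is the
ONLY place in the chain (N256) → (T2′) → (T2) → positions where `Squarefree N_W` is used — everywhere else it is merely carried (grep of
…SigmaNodeMid, …MidWalk, …Positions, …SigmaNodeSeventeenFree: `hsf` is passed, never consumed).  Here the shape is excluded WITHOUT it: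
1. `+256 ∧ α = −34` pins `(c₄, c₆)(W₀) = (α² − 24β, −α³ + 36αβ) = (481, 4879) = (c₄, c₆)(15a1)` with `β = 225/8`, so `W₀ ≅ 15a1 = [1,1,1,−10,−10]
   = X₀(15)` over `ℚ` (tree `exists_variableChange_of_c₄_eq_of_c₆_eq'`) — exactly as GEN 19 pinned the `−256` shape to `17a1`;
2. `N_{15a1} = 15`: the integer model is semistable (`gcd(Δ, c₄) = gcd(50625, 481) = 1`), so its conductor is the radical of `Δ = 15⁴`
   (tree engine `BurungaleSkinner2023.conductorNorm_baseChange_int_of_isCoprime`, Silverman ATAEC IV.10.2), and the conductor is a `ℚ`-isomorphism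
   invariant (`conductorNorm_smul_rat`);
3. `N_W = N_{W₀}`: `W ~ W₀` (same newform; Faltings, tree `isIsogenous_iff_frobeniusTrace_eq_holds`) and the conductor is an isogeny invariant for
   curves with good reduction at `2` (Ogg–Saito in Galois form, tree `IsogenyMuShift.conductorNorm_eq_of_isIsogenous_of_hasGoodReductionAtPrime_two`);
so `N_W = 15`, contradicting the habitat hypothesis `N_W ≠ 15` — at squarefree AND non-squarefree level alike.

* `exists_smul_eq_15a1_of_fifteenShape`, `conductorNorm_15a1` (with the tree's `Thorne2019.fifteenA1_int_Δ/_c₄`), `false_of_fifteenShape_all`;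
* `partnerNotCentre_of_sigmaNode_all` — (T2′) «the MID point's 2-isogenous partner is not a centre» from (N256) + UBD + Edixhoven, now WITHOUT the
  `Squarefree (W.conductorNorm ℤ)` binder (otherwise verbatim `partnerNotCentre_of_sigmaNode_free`).

PURPOSE: the all-levels (T2′) feeds an all-levels MID walk and positions glue (Theorems/…StarOptBAllLevels), which proves `StarOptB` at EVERY level
`N ≠ 15` from (N256) + UBD + Edixhoven — so E1M no longer needs the optimal `Γ₁(N)`-datum print (line `star` v16: THREE prints).
CONDITIONAL on UBD + Edixhoven (THEOREM A) and on (N256) where stated; no `sorry`, no new definition;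
nothing here reads `r_an`; StarOptB / E1M / BSD are NOT proved (PARTITION D-0054: none — r_an ≥ 2 axis S0; no S0 motion).
-/

set_option linter.dupNamespace false
set_option autoImplicit false

noncomputable section

open scoped Classical MatrixGroups
open CongruenceSubgroup
open WeierstrassCurve Literature.NumberTheory.EllipticCurves Literature.NumberTheory.EllipticCurves.Greenberg1999
open Literature.NumberTheory.EllipticCurves.ModularForms

namespace Summit.BirchSwinnertonDyer.BirchSwinnertonDyer.Theorems.DepletionAtTwo.SigmaNode

/-! ### §1 The curve `15a1 = X₀(15)` and its conductor -/

/-- The rational model `[1,1,1,−10,−10]` is the base change of the integer one. [folklore] -/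
theorem fifteenA1_baseChange : (⟨1, 1, 1, -10, -10⟩ : WeierstrassCurve ℤ).baseChange ℚ = ⟨1, 1, 1, -10, -10⟩ := by
  ext <;> simp [baseChange, map]

/-- `(c₄, c₆)(15a1) = (481, 4879)` on the rational model. [cite: CremonaAlgorithms1997, Table 1 (15a1)] -/
theorem fifteenA1_c₄_c₆ : (⟨1, 1, 1, -10, -10⟩ : WeierstrassCurve ℚ).c₄ = 481 ∧ (⟨1, 1, 1, -10, -10⟩ : WeierstrassCurve ℚ).c₆ = 4879 := by
  simp only [WeierstrassCurve.c₄, WeierstrassCurve.c₆, WeierstrassCurve.b₂, WeierstrassCurve.b₄, WeierstrassCurve.b₆]; norm_num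

/-- **`N(15a1) = 15`**: the integer model `[1,1,1,−10,−10]` is semistable (`gcd(Δ, c₄) = 1`), so its conductor is the radical of `Δ = 15⁴`
(Silverman ATAEC IV.10.2 via the tree engine `conductorNorm_baseChange_int_of_isCoprime`). [cite: Silverman1994, IV.10.2 (a),(b)] [cite: CremonaAlgorithms1997, Table 1 (15a1)] -/
theorem conductorNorm_15a1 : (⟨1, 1, 1, -10, -10⟩ : WeierstrassCurve ℚ).conductorNorm ℤ = 15 := by
  rw [← fifteenA1_baseChange]
  haveI : ((⟨1, 1, 1, -10, -10⟩ : WeierstrassCurve ℤ).baseChange ℚ).IsElliptic := by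
    rw [fifteenA1_baseChange, WeierstrassCurve.isElliptic_iff]
    simp only [WeierstrassCurve.Δ, WeierstrassCurve.b₂, WeierstrassCurve.b₄, WeierstrassCurve.b₆, WeierstrassCurve.b₈]
    norm_num
  refine Literature.NumberTheory.EllipticCurves.BurungaleSkinner2023.conductorNorm_baseChange_int_of_isCoprime _ ?_ (k := 4) ?_ ?_ ?_
  · rw [Literature.NumberTheory.Automorphic.Thorne2019.fifteenA1_int_Δ, Literature.NumberTheory.Automorphic.Thorne2019.fifteenA1_int_c₄,
      Int.isCoprime_iff_gcd_eq_one]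
    decide
  · rw [Nat.squarefree_iff_nodup_primeFactorsList (by norm_num)]; simp
  · rw [Literature.NumberTheory.Automorphic.Thorne2019.fifteenA1_int_Δ]; decide
  · rw [Literature.NumberTheory.Automorphic.Thorne2019.fifteenA1_int_Δ]; decide

/-! ### §2 The `15a1` shape pins `W₀` up to `ℚ`-isomorphism -/

/-- **The `+256`/`α = −34` shape is the `15a1` shape**: it forces `β = 225/8`, `(c₄, c₆)(W₀) = (481, 4879)`, hence `C • W₀ = 15a1 = [1,1,1,−10,−10]`
for some change of variables. [cite: SilvermanAEC2009, III.1 Table 3.1] [cite: CremonaAlgorithms1997, Table 1 (15a1)] -/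
theorem exists_smul_eq_15a1_of_fifteenShape (W₀ : WeierstrassCurve ℚ) [W₀.IsElliptic]
    {x₀ : ℚ} (hx₀ : HasRationalTwoTorsionX W₀ x₀)
    (h256 : (W₀.b₂ + 12 * x₀) ^ 2 - 32 * (W₀.b₄ + x₀ * W₀.b₂ + 6 * x₀ ^ 2) = 256) (hα : W₀.b₂ + 12 * x₀ = -34) :
    ∃ C : VariableChange ℚ, C • W₀ = ⟨1, 1, 1, -10, -10⟩ := by
  obtain ⟨hc₄, hc₆⟩ := c₄_c₆_eq_of_twoTorsion W₀ hx₀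
  have hsq : (W₀.b₂ + 12 * x₀) ^ 2 = 1156 := by rw [hα]; norm_num
  have hβ : W₀.b₄ + x₀ * W₀.b₂ + 6 * x₀ ^ 2 = 225 / 8 := by linarith
  have h4 : W₀.c₄ = 481 := by rw [hc₄, hsq, hβ]; norm_num
  have h6 : W₀.c₆ = 4879 := by rw [hc₆, hβ, hα]; norm_num
  obtain ⟨hM4, hM6⟩ := fifteenA1_c₄_c₆
  exact exists_variableChange_of_c₄_eq_of_c₆_eq' (w := (1 : ℚ)) one_ne_zero (by rw [hM4, h4]; norm_num) (by rw [hM6, h6]; norm_num)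

/-! ### §3 The `+256` branch at every level -/

/-- **`+256` and `α = −34` on the lattice-optimal curve of a habitat class is impossible AT EVERY LEVEL** (no squarefree hypothesis):
`W₀ ≅ 15a1` (§2), so `N_{W₀} = N_{15a1} = 15` (`conductorNorm_smul_rat`, §1); `W ~ W₀` (same newform, Faltings) and both have good reduction at `2`,
so `N_W = N_{W₀}` (Ogg–Saito, tree `IsogenyMuShift.conductorNorm_eq_of_isIsogenous_of_hasGoodReductionAtPrime_two`); contradiction with `N_W ≠ 15`.
[cite: SilvermanATAEC1994, Exercise 4.40 with Thm. IV.11.1] [cite: CremonaAlgorithms1997, Table 1 (15a1)] -/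
theorem false_of_fifteenShape_all
    (W : WeierstrassCurve ℚ) [W.IsElliptic] [W.IsGloballyMinimal] (hord : IsOrdinaryAt W 2)
    (h15 : W.conductorNorm ℤ ≠ 15)
    {N : ℕ} [NeZero N] (f : CuspForm (Gamma0 N) 2) (hW : IsNewformOf W f)
    (W₀ : WeierstrassCurve ℚ) [W₀.IsElliptic] [W₀.IsGloballyMinimal] (hW₀ : IsNewformOf W₀ f)
    {x₀ : ℚ} (hx₀ : HasRationalTwoTorsionX W₀ x₀)
    (h256 : (W₀.b₂ + 12 * x₀) ^ 2 - 32 * (W₀.b₄ + x₀ * W₀.b₂ + 6 * x₀ ^ 2) = 256) (hα : W₀.b₂ + 12 * x₀ = -34) : False := by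
  obtain ⟨C, hC⟩ := exists_smul_eq_15a1_of_fifteenShape W₀ hx₀ h256 hα
  have hiso : WeierstrassCurve.IsIsogenous W W₀ :=
    IsNewformOf.isIsogenous WeierstrassCurve.isIsogenous_iff_frobeniusTrace_eq_holds hW hW₀
  have hNW : W.conductorNorm ℤ = W₀.conductorNorm ℤ :=
    Summit.BirchSwinnertonDyer.BirchSwinnertonDyer.Theorems.IsogenyMuShift.conductorNorm_eq_of_isIsogenous_of_hasGoodReductionAtPrime_two
      hiso hord.1
  have hN₀ : W₀.conductorNorm ℤ = 15 := by
    rw [← conductorNorm_smul_rat W₀ C, hC]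
    exact conductorNorm_15a1
  exact h15 (hNW.trans hN₀)

/-! ### §4 (T2′) from (N256) and the prints UBD + Edixhoven, at every level -/

/-- **(T2′) «the MID point's 2-isogenous partner is not a centre» from the node law (N256) and TWO PRINTS (UBD, Edixhoven: THEOREM A), AT EVERY LEVEL**
— the statement of `partnerNotCentre_of_sigmaNode_free` WITHOUT the `Squarefree (W.conductorNorm ℤ)` binder: `+256` branch by `false_of_fifteenShape_all`,
`−256` branch by `false_of_seventeenShape_free` (already squarefree-free).  CONDITIONAL on the two prints and on (N256).
[cite: CalegariDimitrovTang2025, Thm. 1.0.1] [cite: Edixhoven1991, Prop. 2] [cite: GreenbergLNM1716, §5 Props. 5.13–5.14] -/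
theorem partnerNotCentre_of_sigmaNode_all
    (hU : Literature.NumberTheory.Automorphic.CalegariDimitrovTang2025_unboundedDenominators)
    (hEd : edixhoven_optimalManinConstant_integral)
    (hN : ∀ (W₀ : WeierstrassCurve ℚ) [W₀.IsElliptic] [W₀.IsGloballyMinimal]
      ⦃N : ℕ⦄ [NeZero N] (f : CuspForm (Gamma0 N) 2), IsNewformOf W₀ f → IsOrdinaryAt W₀ 2 →
      ∀ (L₀ : PeriodPair), IsNeronLatticeOf (W₀.baseChange ℂ) L₀ → ∀ (q : ℚ), q ≠ 0 →
      (∀ z ∈ periodLattice f, (q : ℂ) * z ∈ L₀.lattice) → (∀ z ∈ L₀.lattice, ∃ w ∈ periodLattice f, z = (q : ℂ) * w) →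
      ∀ (x : ℚ), HasRationalTwoTorsionX W₀ x → TwoTorsionRamifiedAtTwo x →
      ∀ (lam : ℂ), lam ∈ L₀.lattice → lam / 2 ∉ L₀.lattice →
        L₀.weierstrassP (lam / 2) - ((W₀.b₂ : ℚ) : ℂ) / 12 = ((x : ℚ) : ℂ) →
      (∀ (γ : SL(2, ℤ)) (hγ : γ ∈ Gamma0 N), γ ∈ Gamma1 N →
        ∃ k : ℤ, ∃ w ∈ L₀.lattice, (q : ℂ) * cuspSymbol f ⟨γ, hγ⟩ = (k : ℂ) * lam + 2 * w) →
      (W₀.b₂ + 12 * x) ^ 2 - 32 * (W₀.b₄ + x * W₀.b₂ + 6 * x ^ 2) = 256 ∨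
        (W₀.b₂ + 12 * x) ^ 2 - 32 * (W₀.b₄ + x * W₀.b₂ + 6 * x ^ 2) = -256) :
    ∀ (W : WeierstrassCurve ℚ) [W.IsElliptic] [W.IsGloballyMinimal] (x : ℚ), IsOrdinaryAt W 2 →
      HasUniqueRationalTwoTorsionX W x →
      ((TwoTorsionRamifiedAtTwo x ∧ ¬ TwoTorsionOdd W x) ∨ (TwoTorsionOdd W x ∧ ¬ TwoTorsionRamifiedAtTwo x)) →
      W.conductorNorm ℤ ≠ 15 →
      ∀ ⦃N : ℕ⦄ [NeZero N] (f : CuspForm (Gamma0 N) 2), IsNewformOf W f →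
      ∀ (W₀ : WeierstrassCurve ℚ) [W₀.IsElliptic] [W₀.IsGloballyMinimal], IsNewformOf W₀ f →
      ∀ (L₀ : PeriodPair), IsNeronLatticeOf (W₀.baseChange ℂ) L₀ → ∀ (q : ℚ), q ≠ 0 →
      (∀ z ∈ periodLattice f, (q : ℂ) * z ∈ L₀.lattice) → (∀ z ∈ L₀.lattice, ∃ w ∈ periodLattice f, z = (q : ℂ) * w) →
      ∀ (x₀ : ℚ), HasRationalTwoTorsionX W₀ x₀ → TwoTorsionRamifiedAtTwo x₀ → TwoTorsionOdd W₀ x₀ →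
      ¬ IsSquare ((W₀.b₄ + x₀ * W₀.b₂ + 6 * x₀ ^ 2) / 2) := by
  intro W _ _ x hord hux htype h15 N _ f hW W₀ _ _ hW₀ L₀ hL₀ q hq hin hout x₀ hx₀ hR₀ hO₀ hsq
  have hiso : WeierstrassCurve.IsIsogenous W W₀ :=
    IsNewformOf.isIsogenous WeierstrassCurve.isIsogenous_iff_frobeniusTrace_eq_holds hW hW₀
  have hord₀ : IsOrdinaryAt W₀ 2 := Summit.BirchSwinnertonDyer.BirchSwinnertonDyer.Theorems.IsogenyMuShift.isOrdinaryAt_of_isIsogenous hiso hord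
  obtain ⟨lam, hlam, hlam2, hwp⟩ := exists_half_period_of_hasRationalTwoTorsionX W₀ L₀ hL₀ hx₀
  have hpar := ThmAFormal.kummerParity_formal_of_mem_gamma1 hU hEd W₀ f hW₀ L₀ hL₀ q hq hin hout x₀ hx₀ hR₀ lam hlam hlam2 hwp
  rcases hN W₀ f hW₀ hord₀ L₀ hL₀ q hq hin hout x₀ hx₀ hR₀ lam hlam hlam2 hwp hpar with h256 | hneg
  · have hα := alpha_eq_neg_of_mid_of_isSquare W₀ hord₀.1 hx₀ hR₀ hO₀ h256 hsq
    exact false_of_fifteenShape_all W hord h15 f hW W₀ hW₀ hx₀ h256 hα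
  · have hα := alpha_eq_of_complDisc_eq_neg_of_isSquare W₀ hord₀.1 hx₀ hR₀ hneg hsq
    exact false_of_seventeenShape_free W hord hux htype f hW W₀ hW₀ hx₀ hneg hα

end Summit.BirchSwinnertonDyer.BirchSwinnertonDyer.Theorems.DepletionAtTwo.SigmaNode

end
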